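import Summits.ResolutionOfSingularities.ResolutionOfSingularities.Theorems.PurelyInseparableDim4ResConeTSectorLossyShadeThree
import HarnessLib
import HarnessLib.Audit.Tags

/-!
# Purely inseparable four-folds — T-SECTOR LOSSY TAILS WITH `4d ≤ p + 3`: ONE HEAVY PERMANENT LETTER, TWO LIGHT ACTIVE LETTERS
# (cell `res-dim4-pi`, K2(p) lane, B-LOSSY rows in the T-sector, every prime and every shade in the regime `4d ≤ p + 3`; seat res-dim4-p-8 g7)

[OURS · counted 0 · cell `res-dim4-pi` · K2(p) lane (holder res-dim4-p-12 g5, B-LOSSY row list bus 2026-08-29 l.6609) · seat res-dim4-p-8 g7.]  **HONEST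
LABEL.**  A p-GENERIC, d-GENERIC LEDGER THEOREM about OUR frame (weights only, no certificate, no `decide`); it confines, it kills nothing.  Nothing
here proves any TAIL(p, d, ·), K2(7), K2(p), `NoIsolatedTrap p p`, CJS 6.40 or resolution of singularities in dimension ≥ 4 / characteristic `p` —
NOT proved.  AI kernel work, weaker than expert review.

THE THEOREM **`tsector_lossy_heavy_letter`**: along a witnessed isolated above-floor `Step0 p` chain with `x^{r₀} ∣ F₀`, constant shade `d` from `k₀`
with `4d ≤ p + 3`, LOSSY beyond every index, and a letter `φ` weightless and uncharted from `k₀` (res-dim4-p-1's T-sector normal form for the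
form-carrying letter of a power cone; any `e_G` here), there are a letter `z ≠ φ` and a time `k₂` such that for every `k ≥ k₂`: `z` is never
charted nor translated, its weight is CONSTANT `= m` with **`p + 2 ≤ m + 2d` and `m + d + 1 ≤ p`**, and every other letter weighs `≤ d − 1`.
So in this regime every T-sector lossy tail is a TWO-ACTIVE-LETTER walk next to one heavy permanent letter — the «e = 3 cousin of R3a» for all
`p`; at `d = 3` the window is `m = p − 4` (`tsector_lossy_shade_three`, with the fine active shape `(2, ≤ 1)`), at `d = 4` it is `m ∈ {p − 6, p − 5}`
(g6's `blf.py` rows at `p = 11, 13`: active `(3), (3,1), (3,2)` resp. `(2), (2,1), (2,2), (3)`).  Outside the regime (`p < 4d − 3`, e.g. `(7, 4…6)`)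
three active letters occur (the zoos of `…WeightLedgerSevenTSectorLossy`).
PROOF (ledger only): floor + triple law on the letters `≠ φ` give `p + 1 − d ≤ |r| ≤ p − 1`, so charts hand out `≤ d − 1`; FT gives two charted
letters; the fourth letter weighs `≥ p + 3 − 3d > d − 1`, hence is never charted, never lost, constant `m`; res-dim4-p-5's
`no_tail_of_permanent_weight_ge` gives `m ≤ p − d − 1`; a lossy step needs `m + (|r| + d − p) ≥ p + 1 − d`, i.e. `m ≥ p + 2 − 2d`.
[cite: CossartJannsenSaito2020, Thm. 3.14] [cite: HauserPerlega2019PRIMS, §2] bears_on: LADDER-RESOLUTION:D157-DOOR2 (res-dim4-pi · K2(p) B-LOSSY ·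
T-sector lossy tails, heavy permanent letter ∀ (p, d) with 4d ≤ p + 3).  Supports stmt-ResolutionOfSingularities-16155 (helper).
-/

set_option linter.dupNamespace false -- mandated namespace of this single-conjunct summit

noncomputable section

namespace Summit.ResolutionOfSingularities.ResolutionOfSingularities.Theorems.PIDim4

namespace ResCone

open MvPolynomial Finset Literature.AlgebraicGeometry.Resolution
open Literature.AlgebraicGeometry.Resolution.CentreBlowup Literature.AlgebraicGeometry.Resolution.Hauser2010
open WeightLedger

section Chain

variable {K : Type} [Field K] (p : ℕ) [Fact p.Prime] [CharP K p] [DecidableEq K]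
  {c : ℕ → State K} {j : ℕ → Fin 4} {b : ℕ → Fin 4 → K}

/-- **T-SECTOR LOSSY TAILS, `4d ≤ p + 3`: ONE HEAVY PERMANENT LETTER** (every prime, every shade in the regime, any `e_G`): a letter `z ≠ φ`
never charted nor translated at late times, of constant weight `m` with `p + 2 ≤ m + 2d` and `m + d + 1 ≤ p`, all other letters weighing `≤ d − 1`.
[OURS] [cite: CossartJannsenSaito2020, Thm. 3.14] -/
theorem tsector_lossy_heavy_letter {d : ℕ} (hpd : 4 * d ≤ p + 3)
    (hc : ∀ k, IsIsolated p (c k).F ∧ Step0 p (c k) (c (k + 1))) (hw : FreeTail.IsWitnessedChain p c j b)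
    (hr0 : ∀ e ∈ (c 0).F.support, (c 0).r ≤ e) (hfloor : ∀ k, ordZero (c k).F ≠ p) {k₀ : ℕ}
    (hshade : ∀ k, k₀ ≤ k → (c k).shade = (d : ℕ∞)) (hlossy : ∀ k₂, ∃ k, k₂ ≤ k ∧ Lossy ⇑(c k).r ⇑(c (k + 1)).r)
    {φ : Fin 4} (hφ : ∀ k, k₀ ≤ k → (c k).r φ = 0 ∧ j k ≠ φ) :
    ∃ (z : Fin 4) (k₂ : ℕ), k₀ ≤ k₂ ∧ z ≠ φ ∧
      p + 2 ≤ (c k₂).r z + 2 * d ∧ (c k₂).r z + d + 1 ≤ p ∧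
      (∀ k, k₂ ≤ k → (c k).r z = (c k₂).r z ∧ j k ≠ z ∧ b k z = 0) ∧
      (∀ k, k₂ ≤ k → ∀ i, i ≠ z → (c k).r i + 1 ≤ d) := by
  classical
  have hleg : ∀ k, k₀ ≤ k → Legal p d ⇑(c k).r := fun k hk => tail_ledger_legal p hc hw hr0 hfloor hshade hk
  have hchild : ∀ k, k₀ ≤ k → ⇑(c (k + 1)).r = child p d ⇑(c k).r (j k) (fun i => decide (b k i = 0)) :=
    fun k hk => tail_ledger_child p hc hw hr0 hfloor hshade hk
  have hnew : ∀ k, k₀ ≤ k → (c (k + 1)).r (j k) = wsum ⇑(c k).r + d - p := fun k hk => by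
    have h1 := congrFun (hchild k hk) (j k); rwa [child_apply_self] at h1
  have hoff : ∀ k, k₀ ≤ k → ∀ i, i ≠ j k → (c (k + 1)).r i = (if b k i = 0 then (c k).r i else 0) :=
    fun k hk i hi => by have h1 := congrFun (hchild k hk) i; rwa [child_apply_of_ne_decide _ hi] at h1
  have hoff_le : ∀ k, k₀ ≤ k → ∀ i, i ≠ j k → (c (k + 1)).r i ≤ (c k).r i := fun k hk i hi => by
    rw [hoff k hk i hi]; split_ifs <;> omega
  -- the band `p + 1 − d ≤ |r| ≤ p − 1`
  obtain ⟨u, v, w, huv, huw, hvw, huφ, hvφ, hwφ⟩ := WeightLedger.exists_three_others φ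
  have hband : ∀ k, k₀ ≤ k → p + 1 ≤ wsum ⇑(c k).r + d ∧ wsum ⇑(c k).r + 1 ≤ p := by
    intro k hk
    obtain ⟨hfl, -, -, htri⟩ := hleg k hk
    have h3 := htri u v w huv huw hvw
    have hs := WeightLedger.wsum_eq_four ⇑(c k).r huv huw huφ hvw hvφ hwφ
    have hφ0 : (⇑(c k).r) φ = 0 := (hφ k hk).1
    constructor <;> omega
  have hnew_le : ∀ k, k₀ ≤ k → 1 ≤ (c (k + 1)).r (j k) ∧ (c (k + 1)).r (j k) + 1 ≤ d := fun k hk => by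
    have h1 := hnew k hk; have h2 := hband k hk; omega
  have persist : ∀ k, k₀ ≤ k → ∀ i, (c k).r i + 1 ≤ d → ∀ n, (c (k + n)).r i + 1 ≤ d := by
    intro k hk i hi n
    induction n with
    | zero => simpa using hi
    | succ n ih =>
      rw [← Nat.add_assoc]
      by_cases hij : i = j (k + n)
      · rw [hij]; exact (hnew_le (k + n) (by omega)).2
      · have := hoff_le (k + n) (by omega) i hij; omega
  -- FT: two distinct charted letters
  obtain ⟨k₁, hk₁, hsat⟩ := exists_satellite_after p hc hw k₀
  set x := j k₁ with hx
  set y := j (k₁ + 1) with hy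
  have hxy : x ≠ y := fun h => hsat.1 (by rw [← hx, ← hy, h])
  have hxφ : x ≠ φ := (hφ k₁ hk₁).2
  have hyφ : y ≠ φ := (hφ (k₁ + 1) (by omega)).2
  set K := k₁ + 2 with hK
  have hxK : ∀ k, K ≤ k → (c k).r x + 1 ≤ d := fun k hk => by
    obtain ⟨n, rfl⟩ := Nat.exists_eq_add_of_le (show k₁ + 1 ≤ k by omega)
    exact persist (k₁ + 1) (by omega) x (hnew_le k₁ hk₁).2 n
  have hyK : ∀ k, K ≤ k → (c k).r y + 1 ≤ d := fun k hk => by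
    obtain ⟨n, rfl⟩ := Nat.exists_eq_add_of_le hk
    have h0 : (c (k₁ + 1 + 1)).r y + 1 ≤ d := (hnew_le (k₁ + 1) (by omega)).2
    exact persist (k₁ + 2) (by omega) y (by simpa [hK] using h0) n
  -- the fourth letter is heavy, hence permanent
  obtain ⟨z, hzx, hzy, hzφ, hexh⟩ := WeightLedger.exists_fourth_letter hxy hxφ hyφ
  have hsum4 : ∀ a : Fin 4 → ℕ, wsum a = a x + a y + a z + a φ :=
    fun a => WeightLedger.wsum_eq_four a hxy hzx.symm hxφ hzy.symm hyφ hzφ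
  have hzK : ∀ k, K ≤ k → p + 3 ≤ (c k).r z + 3 * d := fun k hk => by
    have h1 := hband k (by omega); have h2 := hsum4 ⇑(c k).r; have h3 := hxK k hk; have h4 := hyK k hk
    have hφ0 : (⇑(c k).r) φ = 0 := (hφ k (by omega)).1
    omega
  have hjz : ∀ k, K ≤ k → j k ≠ z := fun k hk hjk => by
    have h1 := (hnew_le k (by omega)).2; rw [hjk] at h1; have h2 := hzK (k + 1) (by omega); omega
  have hbz : ∀ k, K ≤ k → b k z = 0 := fun k hk => by
    by_contra hne
    have h1 := hoff k (by omega) z (Ne.symm (hjz k hk)); rw [if_neg hne] at h1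
    have h2 := hzK (k + 1) (by omega); omega
  have hzconst : ∀ k, K ≤ k → (c k).r z = (c K).r z := by
    intro k hk
    obtain ⟨n, rfl⟩ := Nat.exists_eq_add_of_le hk
    induction n with
    | zero => rfl
    | succ n ih =>
      rw [← ih (by omega), ← Nat.add_assoc]
      have h1 := hoff (K + n) (by omega) z (Ne.symm (hjz (K + n) (by omega)))
      rwa [if_pos (hbz (K + n) (by omega))] at h1
  set m := (c K).r z with hm
  -- heavy bound (res-dim4-p-5)
  have hmU : m + d + 1 ≤ p := by
    by_contra hlt
    refine no_tail_of_permanent_weight_ge p hc hw hr0 hfloor hshade (M := K) (by omega) (P := {z}) ?_ ?_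
    · intro z' hz' m' hm'
      rw [Finset.mem_singleton] at hz'; subst hz'
      exact ⟨Ne.symm (hjz m' hm'), hbz m' hm'⟩
    · rw [Finset.sum_singleton]; omega
  -- lossy bound
  have hloss : ∀ k, K ≤ k → Lossy ⇑(c k).r ⇑(c (k + 1)).r →
      wsum ⇑(c (k + 1)).r = wsum ⇑(c k).r + d - p + m := by
    intro k hk ⟨i, hi1, hi0⟩
    have hkk : k₀ ≤ k := by omega
    have hφ0 : (⇑(c k).r) φ = 0 := (hφ k hkk).1
    have hφ0' : (⇑(c (k + 1)).r) φ = 0 := (hφ (k + 1) (by omega)).1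
    have hzk1 : (c (k + 1)).r z = m := hzconst (k + 1) (by omega)
    have hzk : (c k).r z = m := hzconst k hk
    have hij : i ≠ j k := fun h => by have := (hnew_le k hkk).1; rw [← h] at this; omega
    have hiz : i ≠ z := fun h => by rw [h] at hi0; have := hzK (k + 1) (by omega); omega
    have hiφ : i ≠ φ := fun h => by rw [h] at hi1; omega
    have hs0 := hsum4 ⇑(c k).r
    have hs1 := hsum4 ⇑(c (k + 1)).r
    have hnk := hnew k hkk
    rcases hexh (j k) with hj | hj | hj | hj
    · rcases hexh i with rfl | rfl | rfl | rfl
      · exact absurd hj.symm hij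
      · rw [hj] at hnk; omega
      · exact absurd rfl hiz
      · exact absurd rfl hiφ
    · rcases hexh i with rfl | rfl | rfl | rfl
      · rw [hj] at hnk; omega
      · exact absurd hj.symm hij
      · exact absurd rfl hiz
      · exact absurd rfl hiφ
    · exact absurd hj (hjz k hk)
    · exact absurd hj (hφ k hkk).2
  have hmL : p + 2 ≤ m + 2 * d := by
    obtain ⟨k, hk, hl⟩ := hlossy K
    have h1 := hloss k hk hl
    have h2 := hband k (by omega); have h3 := hband (k + 1) (by omega)
    omega
  refine ⟨z, K, by omega, hzφ, hmL, hmU, fun k hk => ⟨hzconst k hk, hjz k hk, hbz k hk⟩, fun k hk i hi => ?_⟩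
  rcases hexh i with rfl | rfl | rfl | rfl
  · exact hxK k hk
  · exact hyK k hk
  · exact absurd rfl hi
  · have hφ0 : (⇑(c k).r) i = 0 := (hφ k (by omega)).1
    have := (hnew_le k (by omega)).1
    have := (hnew_le k (by omega)).2
    omega

end Chain

end ResCone

end Summit.ResolutionOfSingularities.ResolutionOfSingularities.Theorems.PIDim4

end
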